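import Summits.ValiantsHypothesis.ValiantsHypothesis.Theorems.KPlusLogSqLawTropicalBActivationCycle

/-!
# Route «KPlusLogSqLaw», crux `TropicalB` (stmt-ValiantsHypothesis-19771) — THE SINGLE-CONTACT LAW: two single-token activations over a
# common base have AT MOST ONE column at which the three cells of `B`, `P`, `Q` are pairwise distinct (conjecture C2, now kernel)

HONEST FRAMING.  Helper toward the registered stubs `stub_tropThin` / `stub_tropFat` of `Cruxes/TropicalB/Lines/birth.lean` (crux
`Summit.ValiantsHypothesis.ValiantsHypothesis.Theses.KPlusLogSqLaw.TropicalB`, item stmt-ValiantsHypothesis-19771, route KPlusLogSqLaw;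
cell `pub-symmetroid`, seat val-sym-trop-p5 g26, refuter-adjacent lane, 2026-08-29; `--supports … --as helper`).  A STRUCTURE law about
unique optima (`IsDominant`) of an ARBITRARY dominance design; nothing here bounds `TropicalB`, and nothing bears on `WeakLifting`,
DoorA26 / DoorA34, `MatrixDescartes` (stmt-ValiantsHypothesis-18050) or VP ≠ VNP.

THE LAW (`single_contact`, `card_tripleColumns_le_one`).  `B`, `P`, `Q` unique optima of one design (at `θB`, `θP`, `θQ`); `P` and `Q`
SINGLE-TOKEN ACTIVATIONS over `B`: the classes of `P` carry the exponents of `B` off one column `eP`, where the exponent goes up, likewise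
`Q` off `eQ` (e.g. `B = M_S`, `P = M_{S+x}`, `Q = M_{S+y}` in a radix-2 odometer).  THEN AT MOST ONE COLUMN CARRIES THREE PAIRWISE DISTINCT
CELLS `B c`, `P c`, `Q c`.  This is conjecture C2 of memo HOME/val-sym-trop-p5/g25/CONTACT-LAWS-g25.md («two single-token activation
cycles over a common state meet in exactly ONE common directed stretch»: a common column of the two exchange cycles either carries the
same cell in `P` and `Q` — a SHARED column, after which both cycles continue to the same column — or is a triple column; contracting the
shared stretches leaves the triple columns), located there on the cell's four kernel cubes (4/4 · 11/11 · 21/21 · 53/53 clean pairs) and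
re-located in triple form by this seat (HOME/val-sym-trop-p5/g26/exp/triple_check.py: 136/136 concentrated pairs on seven cube chains have
exactly one triple column).  With the sunflower law (`…TropicalBDisjointDeviations`: the deviations meet) the count is exactly one when
`P ≠ Q`; that half is not restated here.

PROOF.  Both deviation sets are single exchange cycles through their token columns (`sameCycle_token`, …TropicalBActivationCycle).  Fix a
triple column `a` and give every column common to the two cycles the torus coordinates `(t, s)`, `col t = (σ_B⁻¹σ_P)^t a`,
`colQ s = (σ_B⁻¹σ_Q)^s a`; `common` points are the common columns other than `a`, `star` points the triple columns other than `a`; a common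
non-star column is shared, so its two successors coincide: the diagonal successor `(t+1, s+1)` is common or the far corner.  The piece
functional `g` of …TropicalBActivationCycle is additive under splitting a box (`pieceFun_add`) and positive on empty boxes between admissible
corners (`piece_pos`), so by the torus staircase lemma (`staircase_total_pos`, …TropicalBTorusStaircase — the «one-run lemma»: refine the
diagonal `a → a + (NP, −NQ)` into a staircase of docked one-run pieces) a second triple column `a'` would force `g(whole torus) > 0`; but
`g(whole torus) = 0` because each activation's valuation gain is counted once with each sign.  No walk splitting, no multi-run pieces.

[this cell; folklore ingredients (exchange cycles, lower hulls)]
-/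

set_option linter.dupNamespace false
set_option autoImplicit false

namespace Summit.ValiantsHypothesis.ValiantsHypothesis.Theorems.KPlusLogSqLaw

namespace SingleContact

/-! ## 6. THE SINGLE-CONTACT LAW -/

section Main

open Summit.ValiantsHypothesis.ValiantsHypothesis.Theorems.MatrixDescartes.Negative
open Summit.ValiantsHypothesis.ValiantsHypothesis.Theorems.LacunarySymmetroidMatrixDescartes
open Finset

variable {m K : ℕ} (d : Fin K → ℕ) (v ε : Fin m → Fin m → Fin K → ℤ)

/-- **THE SINGLE-CONTACT LAW (triple form).**  Let `B`, `P`, `Q` be unique optima of one design (at `θB`, `θP`, `θQ`), `P` and `Q`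
SINGLE-TOKEN ACTIVATIONS over `B`: the classes of `P` carry the exponents of `B` off one column `eP`, where the exponent goes up, and
likewise `Q` off `eQ` (e.g. `B = M_S`, `P = M_{S+x}`, `Q = M_{S+y}` in a radix-2 odometer).  Then there is AT MOST ONE column at which the
three cells of `B`, `P`, `Q` are pairwise distinct.  Equivalently (conjecture C2 of memo CONTACT-LAWS-g25.md, located there on the cell's four
kernel cubes as 4/4 · 11/11 · 21/21 · 53/53): after contracting shared stretches the exchange cycles `Z_P`, `Z_Q` of the two activations meet
in exactly ONE vertex — one common directed stretch.  Proof: both deviation sets are single cycles through their token columns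
(`sameCycle_token`); in the torus coordinates `(t, s)` of the common columns from a base column `a` of the triple kind, a second such column
would make the piece functional of the whole torus positive (`staircase_total_pos`: refine the diagonal `a → a + (NP, −NQ)` into a staircase
of docked one-run pieces with empty boxes, each in deficit by `piece_pos`), whereas it is `0` (each activation's valuation gain is counted once
with each sign). [this cell; folklore ingredients] -/
theorem single_contact {θB θP θQ : ℤ} {B P Q : Equiv.Perm (Fin m) × (Fin m → Fin K)}
    (hB : IsDominant d v ε θB B) (hP : IsDominant d v ε θP P) (hQ : IsDominant d v ε θQ Q) (eP eQ : Fin m)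
    (hcP : ∀ i, i ≠ eP → d (P.2 i) = d (B.2 i)) (hcQ : ∀ i, i ≠ eQ → d (Q.2 i) = d (B.2 i))
    (hδP : d (B.2 eP) < d (P.2 eP)) (hδQ : d (B.2 eQ) < d (Q.2 eQ))
    {a a' : Fin m}
    (haP : ¬ (P.1 a = B.1 a ∧ P.2 a = B.2 a)) (haQ : ¬ (Q.1 a = B.1 a ∧ Q.2 a = B.2 a))
    (haPQ : ¬ (P.1 a = Q.1 a ∧ P.2 a = Q.2 a))
    (ha'P : ¬ (P.1 a' = B.1 a' ∧ P.2 a' = B.2 a')) (ha'Q : ¬ (Q.1 a' = B.1 a' ∧ Q.2 a' = B.2 a'))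
    (ha'PQ : ¬ (P.1 a' = Q.1 a' ∧ P.2 a' = Q.2 a')) : a = a' := by
  classical
  by_contra hne
  -- torus coordinates from the base column `a`
  set NP : ℕ := Function.minimalPeriod (B.1⁻¹ * P.1) a with hNPdef
  set NQ : ℕ := Function.minimalPeriod (B.1⁻¹ * Q.1) a with hNQdef
  set col : ℕ → Fin m := fun t => ((B.1⁻¹ * P.1) ^ t) a with hcoldef
  set colQ : ℕ → Fin m := fun s => ((B.1⁻¹ * Q.1) ^ s) a with hcolQdef
  have hc0 : col 0 = a := by simp [hcoldef]
  have hq0 : colQ 0 = a := by simp [hcolQdef]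
  have hcs : ∀ t, B.1.symm (P.1 (col t)) = col (t + 1) := fun t => by
    simp only [hcoldef]; rw [pow_succ_apply]; rfl
  have hqs : ∀ s, B.1.symm (Q.1 (colQ s)) = colQ (s + 1) := fun s => by
    simp only [hcolQdef]; rw [pow_succ_apply]; rfl
  have hci : ∀ t t', t < NP → t' < NP → col t = col t' → t = t' := fun t t' ht ht' h => pow_apply_injOn _ a ht ht' h
  have hqi : ∀ s s', s < NQ → s' < NQ → colQ s = colQ s' → s = s' := fun s s' hs hs' h => pow_apply_injOn _ a hs hs' h
  have hcN : col NP = col 0 := by rw [hc0]; exact pow_minimalPeriod_apply _ a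
  have hqN : colQ NQ = colQ 0 := by rw [hq0]; exact pow_minimalPeriod_apply _ a
  have h00 : col 0 = colQ 0 := by rw [hc0, hq0]
  have hNP : 0 < NP := minimalPeriod_pos _ a
  have hNQ : 0 < NQ := minimalPeriod_pos _ a
  have hcdev : ∀ t, ¬ (P.1 (col t) = B.1 (col t) ∧ P.2 (col t) = B.2 (col t)) := coord_dev haP
  have hqdev : ∀ s, ¬ (Q.1 (colQ s) = B.1 (colQ s) ∧ Q.2 (colQ s) = B.2 (colQ s)) := coord_dev haQ
  have hccov : ∀ c, ¬ (P.1 c = B.1 c ∧ P.2 c = B.2 c) → ∃ t, t < NP ∧ col t = c :=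
    fun c hc => coord_exists d v ε hB hP eP hcP hδP haP hc
  have hqcov : ∀ c, ¬ (Q.1 c = B.1 c ∧ Q.2 c = B.2 c) → ∃ s, s < NQ ∧ colQ s = c :=
    fun c hc => coord_exists d v ε hB hQ eQ hcQ hδQ haQ hc
  clear_value col colQ NP NQ
  -- the second triple column, in coordinates
  obtain ⟨t', ht'NP, hct'⟩ := hccov a' ha'P
  obtain ⟨s', hs'NQ, hqs'⟩ := hqcov a' ha'Q
  have ht'0 : 0 < t' := by
    rcases Nat.eq_zero_or_pos t' with h | h
    · exact absurd (hc0.symm.trans (h ▸ hct')) hne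
    · exact h
  have hs'0 : 0 < s' := by
    rcases Nat.eq_zero_or_pos s' with h | h
    · exact absurd (hq0.symm.trans (h ▸ hqs')) hne
    · exact h
  -- the data of the staircase lemma
  set common : ℕ → ℕ → Prop := fun t s => 0 < t ∧ t < NP ∧ 0 < s ∧ s < NQ ∧ col t = colQ s with hcommon
  set star : ℕ → ℕ → Prop := fun t s => common t s ∧ ¬ (P.1 (col t) = Q.1 (col t) ∧ P.2 (col t) = Q.2 (col t)) with hstar
  set g : ℕ → ℕ → ℕ → ℕ → ℤ := fun tU tW sW sU =>
    ((∑ i ∈ (Finset.Ico tU tW).image col, (v (P.1 i) i (P.2 i) - v (B.1 i) i (B.2 i)))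
        - (if eP ∈ (Finset.Ico tU tW).image col then (∑ i, v (P.1 i) i (P.2 i)) - ∑ i, v (B.1 i) i (B.2 i) else 0))
    + ((∑ i ∈ (Finset.Ico sW sU).image colQ, (v (Q.1 i) i (Q.2 i) - v (B.1 i) i (B.2 i)))
        - (if eQ ∈ (Finset.Ico sW sU).image colQ then (∑ i, v (Q.1 i) i (Q.2 i)) - ∑ i, v (B.1 i) i (B.2 i) else 0)) with hg
  have hint : ∀ t s, common t s → 0 < t ∧ t < NP ∧ 0 < s ∧ s < NQ := fun t s h => ⟨h.1, h.2.1, h.2.2.1, h.2.2.2.1⟩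
  have hsc : ∀ t s, star t s → common t s := fun t s h => h.1
  have hinj₁ : ∀ t s s', common t s → common t s' → s = s' :=
    fun t s s' h h' => hqi s s' h.2.2.2.1 h'.2.2.2.1 (h.2.2.2.2.symm.trans h'.2.2.2.2)
  have hinj₂ : ∀ t t' s, common t s → common t' s → t = t' :=
    fun t t' s h h' => hci t t' h.2.1 h'.2.1 (h.2.2.2.2.trans h'.2.2.2.2.symm)
  have hdiag : ∀ t s, common t s → ¬ star t s → common (t + 1) (s + 1) ∨ (t + 1 = NP ∧ s + 1 = NQ) := by
    intro t s hc hns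
    obtain ⟨h0t, htNP, h0s, hsNQ, heq⟩ := hc
    have hcell : P.1 (col t) = Q.1 (col t) ∧ P.2 (col t) = Q.2 (col t) := by
      by_contra h; exact hns ⟨⟨h0t, htNP, h0s, hsNQ, heq⟩, h⟩
    have hstep : col (t + 1) = colQ (s + 1) := by rw [← hcs, ← hqs, hcell.1, heq]
    rcases Nat.lt_or_ge (t + 1) NP with ht1 | ht1
    · left
      refine ⟨Nat.succ_pos _, ht1, Nat.succ_pos _, ?_, hstep⟩
      by_contra hs1
      have hs1' : s + 1 = NQ := by omega
      rw [hs1', hqN, ← h00] at hstep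
      have := hci (t + 1) 0 ht1 hNP hstep
      omega
    · right
      have ht1' : t + 1 = NP := by omega
      refine ⟨ht1', ?_⟩
      by_contra hs1
      rw [ht1', hcN, h00] at hstep
      have := hqi 0 (s + 1) hNQ (by omega) hstep
      omega
  have hadd : ∀ tU t tW sW s sU, tU ≤ t → t ≤ tW → sW ≤ s → s ≤ sU → tW ≤ NP → sU ≤ NQ →
      g tU tW sW sU = g tU t s sU + g t tW sW s := by
    intro tU t tW sW s sU h1 h2 h3 h4 h5 h6
    simp only [hg]
    have e1 := pieceFun_add col NP hci (fun i => v (P.1 i) i (P.2 i) - v (B.1 i) i (B.2 i)) eP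
      ((∑ i, v (P.1 i) i (P.2 i)) - ∑ i, v (B.1 i) i (B.2 i)) h1 h2 h5
    have e2 := pieceFun_add colQ NQ hqi (fun i => v (Q.1 i) i (Q.2 i) - v (B.1 i) i (B.2 i)) eQ
      ((∑ i, v (Q.1 i) i (Q.2 i)) - ∑ i, v (B.1 i) i (B.2 i)) h3 h4 h6
    beta_reduce at e1 e2
    rw [e1, e2]
    ring
  have hbase : ∀ tU sU tW sW, ((tU = 0 ∧ sU = NQ) ∨ star tU sU) → ((tW = NP ∧ sW = 0) ∨ star tW sW) →
      ¬ (tU = 0 ∧ tW = NP) → tU < tW → sW < sU →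
      (∀ t s, common t s → ¬ (tU < t ∧ t < tW ∧ sW < s ∧ s < sU)) → 0 < g tU tW sW sU := by
    intro tU sU tW sW hU hW hni htUW hsWU hempty
    simp only [hg]
    have htW : tW ≤ NP := by
      rcases hW with ⟨h, _⟩ | h
      · exact h.le
      · exact h.1.2.1.le
    have hsU : sU ≤ NQ := by
      rcases hU with ⟨_, h⟩ | h
      · exact h.le
      · exact h.1.2.2.2.1.le
    have hU' : col tU = colQ sU := by
      rcases hU with ⟨h1, h2⟩ | h
      · rw [h1, h2, hqN, h00]
      · exact h.1.2.2.2.2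
    have hW' : col tW = colQ sW := by
      rcases hW with ⟨h1, h2⟩ | h
      · rw [h1, h2, hcN, h00]
      · exact h.1.2.2.2.2
    have hUstar : ¬ (P.1 (col tU) = Q.1 (col tU) ∧ P.2 (col tU) = Q.2 (col tU)) := by
      rcases hU with ⟨h1, _⟩ | h
      · rw [h1, hc0]; exact haPQ
      · exact h.2
    have hWstar : ¬ (P.1 (col tW) = Q.1 (col tW) ∧ P.2 (col tW) = Q.2 (col tW)) := by
      rcases hW with ⟨h1, _⟩ | h
      · rw [h1, hcN, hc0]; exact haPQ
      · exact h.2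
    have hbox : ∀ t s, tU < t → t < tW → sW < s → s < sU → col t ≠ colQ s := by
      intro t s h1 h2 h3 h4 heq
      exact hempty t s ⟨by omega, by omega, by omega, by omega, heq⟩ ⟨h1, h2, h3, h4⟩
    exact piece_pos d v ε hB hP hQ eP eQ hcP hcQ hδP hδQ col colQ NP NQ hcs hqs hci hqi hcN hqN h00 hcdev
      htUW htW hsWU hsU hU' hW' hUstar hWstar hni hbox
  -- the whole torus: each activation's valuation gain is counted once with each sign
  have htotal : g 0 NP 0 NQ = 0 := by
    simp only [hg]
    have hA : (∑ i ∈ (Finset.Ico 0 NP).image col, (v (P.1 i) i (P.2 i) - v (B.1 i) i (B.2 i))) =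
        (∑ i, v (P.1 i) i (P.2 i)) - ∑ i, v (B.1 i) i (B.2 i) := by
      rw [← sum_sub_distrib]
      apply sum_subset (subset_univ _)
      intro i _ hi
      have hcell : P.1 i = B.1 i ∧ P.2 i = B.2 i := by
        by_contra h
        obtain ⟨t, ht, rfl⟩ := hccov i h
        exact hi (mem_image.2 ⟨t, mem_Ico.2 ⟨Nat.zero_le _, ht⟩, rfl⟩)
      rw [hcell.1, hcell.2]; ring
    have hD : (∑ i ∈ (Finset.Ico 0 NQ).image colQ, (v (Q.1 i) i (Q.2 i) - v (B.1 i) i (B.2 i))) =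
        (∑ i, v (Q.1 i) i (Q.2 i)) - ∑ i, v (B.1 i) i (B.2 i) := by
      rw [← sum_sub_distrib]
      apply sum_subset (subset_univ _)
      intro i _ hi
      have hcell : Q.1 i = B.1 i ∧ Q.2 i = B.2 i := by
        by_contra h
        obtain ⟨s, hs, rfl⟩ := hqcov i h
        exact hi (mem_image.2 ⟨s, mem_Ico.2 ⟨Nat.zero_le _, hs⟩, rfl⟩)
      rw [hcell.1, hcell.2]; ring
    have heA : eP ∈ (Finset.Ico 0 NP).image col := by
      obtain ⟨t, ht, hct⟩ := hccov eP (dev_token d eP hδP)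
      exact mem_image.2 ⟨t, mem_Ico.2 ⟨Nat.zero_le _, ht⟩, hct⟩
    have heD : eQ ∈ (Finset.Ico 0 NQ).image colQ := by
      obtain ⟨s, hs, hcs'⟩ := hqcov eQ (dev_token d eQ hδQ)
      exact mem_image.2 ⟨s, mem_Ico.2 ⟨Nat.zero_le _, hs⟩, hcs'⟩
    rw [if_pos heA, if_pos heD, hA, hD]
    ring
  have hpos : 0 < g 0 NP 0 NQ :=
    staircase_total_pos NP NQ common star g hint hsc hinj₁ hinj₂ hdiag hadd hbase (t' := t') (s' := s')
      ⟨⟨ht'0, ht'NP, hs'0, hs'NQ, hct'.trans hqs'.symm⟩, by rw [hct']; exact ha'PQ⟩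
  rw [htotal] at hpos
  exact lt_irrefl _ hpos

/-- **Corollary (the law as a cardinality bound):** the set of columns at which `B`, `P`, `Q` are pairwise distinct has at most one
element. [this cell] -/
theorem card_tripleColumns_le_one {θB θP θQ : ℤ} {B P Q : Equiv.Perm (Fin m) × (Fin m → Fin K)}
    (hB : IsDominant d v ε θB B) (hP : IsDominant d v ε θP P) (hQ : IsDominant d v ε θQ Q) (eP eQ : Fin m)
    (hcP : ∀ i, i ≠ eP → d (P.2 i) = d (B.2 i)) (hcQ : ∀ i, i ≠ eQ → d (Q.2 i) = d (B.2 i))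
    (hδP : d (B.2 eP) < d (P.2 eP)) (hδQ : d (B.2 eQ) < d (Q.2 eQ)) :
    (univ.filter fun c : Fin m => ¬ (P.1 c = B.1 c ∧ P.2 c = B.2 c) ∧ ¬ (Q.1 c = B.1 c ∧ Q.2 c = B.2 c) ∧
      ¬ (P.1 c = Q.1 c ∧ P.2 c = Q.2 c)).card ≤ 1 := by
  classical
  rw [Finset.card_le_one]
  intro a ha a' ha'
  simp only [mem_filter, mem_univ, true_and] at ha ha'
  exact single_contact d v ε hB hP hQ eP eQ hcP hcQ hδP hδQ ha.1 ha.2.1 ha.2.2 ha'.1 ha'.2.1 ha'.2.2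

end Main

end SingleContact

end Summit.ValiantsHypothesis.ValiantsHypothesis.Theorems.KPlusLogSqLaw
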